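/-
Copyright: the b2b-balaban T⁴-continuum CRUX team, row NE7b OWNER lineage `t4-ne7b-p1` (gen 130). Project licence.
-/
import Summits.QuantumFields.BalabanUV.T4Continuum.Spine.NE7b.SupExpFamilyDerivative
import Summits.QuantumFields.BalabanUV.T4Continuum.Spine.NE7b.SupTiltedFamilyLetters

/-!
# THE SIX MOMENT LETTERS OF THE ROAD'S TWO-SITE TILTED FAMILY: with `Φ₀ = e^{−V}`, `A = F_y(ω_y+ψ₀,y)`, `B = G_z(ω_z+ψ₀,z)` (`|F|, |G| ≤ c₂u²`),
# `H(s,t) = ∫Φ₀e^{sA+tB}dN(0,Γ)` and `M = exp(2(Δ+1)2e·ε̃'_ΨA_τ^v)` the single-site Gaussian-moment constant of (332a),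
#   `∫Φ₀|A|e^{sA+tB} ≤ H·c₂δ₀⁻¹M`,  `∫Φ₀|A²|e^{sA+tB} ≤ H·2c₂²δ₀⁻²M`,  `∫Φ₀|AB|e^{sA+tB} ≤ H·2c₂²δ₀⁻²M`,  `∫Φ₀|AB²|e^{sA+tB} ≤ H·6c₂³δ₀⁻³M`
# (and the same with `B`) for all `|s|, |t| ≤ 1`, uniformly in the volume — the letters `m_X` of (331) discharged by (332a)'s single-site
# letter, `u^{2k} ≤ C_kδ₀^{−k}e^{δ₀u²}` and Young's inequality `|a|b² ≤ ⅓|a|³ + ⅔|b|³` (row NE7b, node U5c; (332a) BY NAME; [folklore])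

Cell `pub-balaban`, sub-cell `t4`, spine estimate NE7b (`T4WeightBudget.RelWeightBound`; the cell's OWN estimate — NOT PRINTED in
[Bałaban 1983–89], NOT PROVED).  Crux-route work under `Spine/NE7b/` by the row OWNER (`t4-ne7b-p1` gen 130, file (332b)) under FREEZE
(0)'s crux-prover clause, on § [NE7bP1-G129-HANDOFF] NEXT (i)∕(ii) (SCOPING-d4); NOTHING of Bałaban's is named as a Lean object, valued or
asserted; no `T4Continuum/Support` leaf typed; no `def`, no notation; zero `sorry`.  Imports (BY NAME): the OWNER's (332a)
`…SupTiltedFamilyLetters` (`road_moment_letter`, `road_four_letter`, `road_H_pos`), (323) (`sq_le_inv_mul_exp_sq`), (328) (`abs_le_exp_abs`);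
Mathlib's `Real.quadratic_le_exp_of_nonneg`, `Real.pow_div_factorial_le_exp`, `integral_mono`, `integral_add`.

WHAT IS PROVED ([folklore]; road data as in (332a), `δ₀ > 0`, `|s|, |t| ≤ 1`):
* §1 pointwise: `pow_four_le_mul_exp_sq`, `pow_six_le_mul_exp_sq`, `young_one_two` (`|a|·|b|·|b| ≤ ⅓|a|³ + ⅔|b|³`),
  `abs_mul_le_half_add` (`|ab| ≤ ½(a·a + b·b)`), `integrable_of_four_letter` (`|X| ≤ Ce^{2(|A|+|B|)}` ⟹ `Φ₀Xe^{sA+tB}` integrable);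
* §2 THE SIX LETTERS **`letter_A`**, **`letter_B`**, **`letter_AA`**, **`letter_BB`**, **`letter_AB`**, **`letter_ABB`** (no toy: the 400-line bound).

HONEST (what this is NOT).  Bookkeeping; the decay assembly is the next file; small-field step only; scalar skeleton ((A3), NC-NE7b-α UNRULED); nothing
of Bałaban's asserted.  BY-NAME EFFECT ON THE WALL: NONE.  NE7b NOT PRINTED ∕ NOT PROVED; spine PROVED 0∕9; rung (B)+1 — FINITE-torus statements only;
NOT the mass gap, NOT Clay.  HONEST DEPENDENCY: continuum YM on T⁴ ⇐ BetaPertH ∧ nine spine estimates (0∕9 proved); BetaPertH ⇐ (D1) ∧ (D4) ∧ CAP+tail.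
-/

set_option autoImplicit false

noncomputable section

namespace Summit.QuantumFields.BalabanUV.T4Continuum.NE7b.SupTiltedMomentLetters

open MeasureTheory ProbabilityTheory Finset Real
open scoped BigOperators
open Literature.Analysis.Matrix (HasFiniteRange)
open SupTiltedFamilyLetters (road_moment_letter road_four_letter road_H_pos)
open SupTiltedSingleSiteMoments (sq_le_inv_mul_exp_sq)
open SupExpFamilyDerivative (abs_le_exp_abs exp_mul_le_exp_abs)

variable {ι : Type} [Fintype ι] [DecidableEq ι] {V : Type*} [DecidableEq V]

/-! ## §1. Pointwise letters -/

/-- `0 < δ ⟹ u⁴ ≤ 2(δ²)⁻¹e^{δu²}` (`½x² ≤ eˣ` at `x = δu²`). [folklore] -/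
theorem pow_four_le_mul_exp_sq {δ : ℝ} (hδ : 0 < δ) (u : ℝ) : u ^ 4 ≤ 2 * (δ ^ 2)⁻¹ * exp (δ * u ^ 2) := by
  have hq := Real.quadratic_le_exp_of_nonneg (by positivity : 0 ≤ δ * u ^ 2)
  have h0 : 0 ≤ δ * u ^ 2 := by positivity
  rw [mul_comm 2, mul_assoc, le_inv_mul_iff₀ (by positivity)]
  nlinarith

/-- `0 < δ ⟹ u⁶ ≤ 6(δ³)⁻¹e^{δu²}` (`x³∕3! ≤ eˣ` at `x = δu²`). [folklore] -/
theorem pow_six_le_mul_exp_sq {δ : ℝ} (hδ : 0 < δ) (u : ℝ) : u ^ 6 ≤ 6 * (δ ^ 3)⁻¹ * exp (δ * u ^ 2) := by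
  have hq := Real.pow_div_factorial_le_exp (δ * u ^ 2) (by positivity) 3
  rw [show Nat.factorial 3 = 6 from rfl] at hq
  push_cast at hq
  rw [div_le_iff₀ (by norm_num : (0 : ℝ) < 6)] at hq
  rw [mul_comm 6, mul_assoc, le_inv_mul_iff₀ (by positivity)]
  nlinarith

/-- **Young**: `|a|·|b|·|b| ≤ ⅓|a|³ + ⅔|b|³` (`p³ − 3pq² + 2q³ = (p−q)²(p+2q) ≥ 0`). [folklore] -/
theorem young_one_two (a b : ℝ) : |a| * |b| * |b| ≤ |a| ^ 3 / 3 + 2 * |b| ^ 3 / 3 := by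
  have hp := abs_nonneg a
  have hq := abs_nonneg b
  have e : |a| ^ 3 / 3 + 2 * |b| ^ 3 / 3 - |a| * |b| * |b| = (|a| - |b|) ^ 2 * (|a| + 2 * |b|) / 3 := by ring
  nlinarith [sq_nonneg (|a| - |b|), mul_nonneg (sq_nonneg (|a| - |b|)) (by positivity : 0 ≤ |a| + 2 * |b|)]

/-- `|ab| ≤ ½(a·a + b·b)`. [folklore] -/
theorem abs_mul_le_half_add (a b : ℝ) : |a * b| ≤ (a * a + b * b) / 2 := by
  rw [abs_mul]
  nlinarith [sq_nonneg (|a| - |b|), abs_mul_abs_self a, abs_mul_abs_self b]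

section Main

variable {Γ : Matrix ι ι ℝ} {γop γ : ℝ} {dι : ι → ι → ℕ} {ρ : ℕ} {cell : V → Finset ι} {v : ℕ} {R : V → V → Prop}
  [DecidableRel R] [Std.Symm R] {nbr : V → Finset V} {Δ : ℕ} {w F G : ι → ℝ → ℝ} {κ₀ c₂ c₃ h κ τ θ Ψ δ₀ : ℝ}

omit [DecidableRel R] [Std.Symm R] in
/-- **Integrability from the `4`-letter**: `X` measurable with `|X| ≤ C·e^{2(|A|+|B|)}`, `|s|, |t| ≤ 1` ⟹ `Φ₀Xe^{sA+tB}` is integrable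
(`|Φ₀Xe^{sA+tB}| ≤ C|Φ₀|e^{3(|A|+|B|)} ≤ C|Φ₀|e^{4(|A|+|B|)}`). [folklore] -/
theorem integrable_of_four_letter (hΓ : Γ.PosSemidef) (hΓop : (γop • (1 : Matrix ι ι ℝ) - Γ).PosSemidef)
    (hdisj : ∀ p q, p ≠ q → Disjoint (cell p) (cell q)) (hw : ∀ x, Measurable (w x)) (hFm : ∀ x, Measurable (F x))
    (hGm : ∀ x, Measurable (G x)) (hκ₀ : 0 ≤ κ₀) (hc₂ : 0 ≤ c₂) (hstab : ∀ x, ∀ u : ℝ, -(κ₀ * u ^ 2) ≤ w x u)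
    (hFq : ∀ x u, |F x u| ≤ c₂ * u ^ 2) (hGq : ∀ x u, |G x u| ≤ c₂ * u ^ 2) (hτ : 0 < τ) (hθ1 : θ < 1)
    (hκθ₈ : 2 * (κ₀ + 2 * (4 * c₂)) * (1 + τ) * γop ≤ θ) (S : Finset V) (ψ₀ : EuclideanSpace ℝ ι) {p₀ p₁ : V} (hp₀ : p₀ ∈ S)
    (hp₁ : p₁ ∈ S) {y z : ι} (hy : y ∈ cell p₀) (hz : z ∈ cell p₁) {X : EuclideanSpace ℝ ι → ℝ} (hX : Measurable X) {C : ℝ} (hC : 0 ≤ C)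
    (hXle : ∀ ω, |X ω| ≤ C * exp (2 * (|F y (ω y + ψ₀ y)| + |G z (ω z + ψ₀ z)|))) {s t : ℝ} (hs : |s| ≤ 1) (ht : |t| ≤ 1) :
    Integrable (fun ω : EuclideanSpace ℝ ι => exp (-(∑ p ∈ S, ∑ x ∈ cell p, w x (ω x + ψ₀ x))) * X ω *
      exp (s * F y (ω y + ψ₀ y) + t * G z (ω z + ψ₀ z))) (multivariateGaussian 0 Γ) := by
  have h4 := road_four_letter hΓ hΓop hdisj hw hFm hGm hκ₀ hc₂ hstab hFq hGq hτ hθ1 hκθ₈ S ψ₀ hp₀ hp₁ hy hz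
  have hAm : Measurable fun ω : EuclideanSpace ℝ ι => F y (ω y + ψ₀ y) :=
    (hFm y).comp ((by fun_prop : Measurable fun ω : EuclideanSpace ℝ ι => ω y).add_const _)
  have hBm : Measurable fun ω : EuclideanSpace ℝ ι => G z (ω z + ψ₀ z) :=
    (hGm z).comp ((by fun_prop : Measurable fun ω : EuclideanSpace ℝ ι => ω z).add_const _)
  have hmeas : AEStronglyMeasurable (fun ω : EuclideanSpace ℝ ι => exp (-(∑ p ∈ S, ∑ x ∈ cell p, w x (ω x + ψ₀ x))) * X ω *
      exp (s * F y (ω y + ψ₀ y) + t * G z (ω z + ψ₀ z))) (multivariateGaussian 0 Γ) :=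
    (((measurable_exp.comp (SupSmallFieldGasReal.measurable_cellSum cell w hw S (fun x => ψ₀ x)).neg).mul hX).mul
      (measurable_exp.comp ((hAm.const_mul s).add (hBm.const_mul t)))).aestronglyMeasurable
  refine (h4.const_mul C).mono' hmeas (ae_of_all _ fun ω => ?_)
  rw [norm_mul, norm_mul, Real.norm_of_nonneg (exp_pos _).le, Real.norm_eq_abs, Real.norm_of_nonneg (exp_pos _).le]
  have he : exp (s * F y (ω y + ψ₀ y) + t * G z (ω z + ψ₀ z)) ≤ exp (|F y (ω y + ψ₀ y)| + |G z (ω z + ψ₀ z)|) := by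
    rw [exp_add, exp_add]
    have h1 := exp_mul_le_exp_abs hs (F y (ω y + ψ₀ y))
    have h2 := exp_mul_le_exp_abs ht (G z (ω z + ψ₀ z))
    rw [one_mul] at h1 h2
    exact mul_le_mul h1 h2 (exp_pos _).le (exp_pos _).le
  have habs : |exp (-(∑ p ∈ S, ∑ x ∈ cell p, w x (ω x + ψ₀ x)))| = exp (-(∑ p ∈ S, ∑ x ∈ cell p, w x (ω x + ψ₀ x))) := abs_of_pos (exp_pos _)
  rw [habs]
  calc exp (-(∑ p ∈ S, ∑ x ∈ cell p, w x (ω x + ψ₀ x))) * |X ω| * exp (s * F y (ω y + ψ₀ y) + t * G z (ω z + ψ₀ z))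
      ≤ exp (-(∑ p ∈ S, ∑ x ∈ cell p, w x (ω x + ψ₀ x))) * (C * exp (2 * (|F y (ω y + ψ₀ y)| + |G z (ω z + ψ₀ z)|))) *
          exp (|F y (ω y + ψ₀ y)| + |G z (ω z + ψ₀ z)|) :=
        mul_le_mul (mul_le_mul_of_nonneg_left (hXle ω) (exp_pos _).le) he (exp_pos _).le (by positivity)
    _ = C * (exp (-(∑ p ∈ S, ∑ x ∈ cell p, w x (ω x + ψ₀ x))) * exp (3 * (|F y (ω y + ψ₀ y)| + |G z (ω z + ψ₀ z)|))) := by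
        rw [mul_assoc, mul_assoc, ← exp_add, mul_left_comm]
        congr 2
        ring
    _ ≤ C * (exp (-(∑ p ∈ S, ∑ x ∈ cell p, w x (ω x + ψ₀ x))) * exp (4 * (|F y (ω y + ψ₀ y)| + |G z (ω z + ψ₀ z)|))) := by
        refine mul_le_mul_of_nonneg_left (mul_le_mul_of_nonneg_left (exp_le_exp.2 ?_) (exp_pos _).le) hC
        nlinarith [abs_nonneg (F y (ω y + ψ₀ y)), abs_nonneg (G z (ω z + ψ₀ z))]

/-! ## §2. THE SIX LETTERS -/

/-- **`∫Φ₀|A|e^{sA+tB} ≤ H·c₂δ₀⁻¹M`** (`|F_y(u)| ≤ c₂u² ≤ c₂δ₀⁻¹e^{δ₀u²}`, (332a) at `q = y`). [folklore] -/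
theorem letter_A (hΓ : Γ.PosSemidef) (hΓop : (γop • (1 : Matrix ι ι ℝ) - Γ).PosSemidef) (hdiag : ∀ i, Γ i i ≤ γ) (hγ : 0 ≤ γ)
    (hfr : HasFiniteRange dι ρ Γ) (hdisj : ∀ p q, p ≠ q → Disjoint (cell p) (cell q)) (hv : ∀ p, (cell p).card ≤ v)
    (hR : ∀ (p p' : V) (x y : ι), x ∈ cell p → y ∈ cell p' → dι x y ≤ ρ → p = p' ∨ R p p') (hΔ : ∀ x, (nbr x).card ≤ Δ)
    (hnbr : ∀ x y, R x y → y ∈ nbr x) (hw : ∀ x, Measurable (w x)) (hFm : ∀ x, Measurable (F x)) (hGm : ∀ x, Measurable (G x)) (hκ₀ : 0 ≤ κ₀)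
    (hc₂ : 0 ≤ c₂) (hc₃ : 0 ≤ c₃) (hh : 0 ≤ h) (hδ₀ : 0 < δ₀) (hstab : ∀ x, ∀ u : ℝ, -(κ₀ * u ^ 2) ≤ w x u)
    (hcub : ∀ x, ∀ u : ℝ, |u| ≤ h → |w x u| ≤ c₃ * |u| ^ 3) (hFq : ∀ x u, |F x u| ≤ c₂ * u ^ 2) (hGq : ∀ x u, |G x u| ≤ c₂ * u ^ 2)
    (hκ : 2 * ((κ₀ + 2 * c₂) + δ₀) ≤ κ) (hτ : 0 < τ) (hθ0 : 0 < θ) (hθ1 : θ < 1) (hκθ : κ * (1 + τ) * γop ≤ θ) (S : Finset V) (ψ₀ : EuclideanSpace ℝ ι)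
    (hψ : ∀ p ∈ S, ∑ x ∈ cell p, ψ₀ x ^ 2 ≤ Ψ ^ 2) {p₀ p₁ : V} (hp₀ : p₀ ∈ S) (hp₁ : p₁ ∈ S) {y z : ι} (hy : y ∈ cell p₀) (hz : z ∈ cell p₁)
    (hsmall : Real.exp 1 * (((max (exp (v * ((c₃ * h ^ 3 + 2 * c₂ * h ^ 2) + δ₀ * h ^ 2)) - 1)
      (2 * exp (-((κ / 2 - ((κ₀ + 2 * c₂) + δ₀)) * h ^ 2)))) * exp (κ * (1 + τ⁻¹) * Ψ ^ 2 / 2)) *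
      ((1 - θ) ^ (-(κ * (1 + τ) * γ / (2 * θ)))) ^ v) * ((Δ : ℝ) + 1) ^ 2 ≤ 1 / 2) {s t : ℝ} (hs : |s| ≤ 1) (ht : |t| ≤ 1) :
    ∫ ω : EuclideanSpace ℝ ι, exp (-(∑ p ∈ S, ∑ x ∈ cell p, w x (ω x + ψ₀ x))) * |F y (ω y + ψ₀ y)| *
        exp (s * F y (ω y + ψ₀ y) + t * G z (ω z + ψ₀ z)) ∂(multivariateGaussian 0 Γ) ≤
      (∫ ω : EuclideanSpace ℝ ι, exp (-(∑ p ∈ S, ∑ x ∈ cell p, w x (ω x + ψ₀ x))) *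
        exp (s * F y (ω y + ψ₀ y) + t * G z (ω z + ψ₀ z)) ∂(multivariateGaussian 0 Γ)) *
      (c₂ * δ₀⁻¹ * exp (2 * ((1 : ℝ) * ((Δ : ℝ) + 1) * (2 * (Real.exp 1 *
        (((max (exp (v * ((c₃ * h ^ 3 + 2 * c₂ * h ^ 2) + δ₀ * h ^ 2)) - 1) (2 * exp (-((κ / 2 - ((κ₀ + 2 * c₂) + δ₀)) * h ^ 2)))) *
          exp (κ * (1 + τ⁻¹) * Ψ ^ 2 / 2)) * ((1 - θ) ^ (-(κ * (1 + τ) * γ / (2 * θ)))) ^ v)))))) := by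
  have hφ : ∀ u : ℝ, |F y u| ≤ c₂ * δ₀⁻¹ * exp (δ₀ * u ^ 2) := fun u =>
    (hFq y u).trans (by rw [mul_assoc]; exact mul_le_mul_of_nonneg_left (sq_le_inv_mul_exp_sq hδ₀ u) hc₂)
  exact road_moment_letter hΓ hΓop hdiag hγ hfr hdisj hv hR hΔ hnbr hw hFm hGm hκ₀ hc₂ hc₃ hh hδ₀.le hstab hcub hFq hGq hκ hτ hθ0 hθ1 hκθ S ψ₀ hψ hp₀ hp₁ hp₀ hy hz hy hsmall (φ := fun u => |F y u|) (fun u => abs_nonneg _) hφ hs ht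
/-- **`∫Φ₀|B|e^{sA+tB} ≤ H·c₂δ₀⁻¹M`** ((332a) at `q = z`). [folklore] -/
theorem letter_B (hΓ : Γ.PosSemidef) (hΓop : (γop • (1 : Matrix ι ι ℝ) - Γ).PosSemidef) (hdiag : ∀ i, Γ i i ≤ γ) (hγ : 0 ≤ γ)
    (hfr : HasFiniteRange dι ρ Γ) (hdisj : ∀ p q, p ≠ q → Disjoint (cell p) (cell q)) (hv : ∀ p, (cell p).card ≤ v)
    (hR : ∀ (p p' : V) (x y : ι), x ∈ cell p → y ∈ cell p' → dι x y ≤ ρ → p = p' ∨ R p p') (hΔ : ∀ x, (nbr x).card ≤ Δ)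
    (hnbr : ∀ x y, R x y → y ∈ nbr x) (hw : ∀ x, Measurable (w x)) (hFm : ∀ x, Measurable (F x)) (hGm : ∀ x, Measurable (G x)) (hκ₀ : 0 ≤ κ₀)
    (hc₂ : 0 ≤ c₂) (hc₃ : 0 ≤ c₃) (hh : 0 ≤ h) (hδ₀ : 0 < δ₀) (hstab : ∀ x, ∀ u : ℝ, -(κ₀ * u ^ 2) ≤ w x u)
    (hcub : ∀ x, ∀ u : ℝ, |u| ≤ h → |w x u| ≤ c₃ * |u| ^ 3) (hFq : ∀ x u, |F x u| ≤ c₂ * u ^ 2) (hGq : ∀ x u, |G x u| ≤ c₂ * u ^ 2)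
    (hκ : 2 * ((κ₀ + 2 * c₂) + δ₀) ≤ κ) (hτ : 0 < τ) (hθ0 : 0 < θ) (hθ1 : θ < 1) (hκθ : κ * (1 + τ) * γop ≤ θ) (S : Finset V) (ψ₀ : EuclideanSpace ℝ ι)
    (hψ : ∀ p ∈ S, ∑ x ∈ cell p, ψ₀ x ^ 2 ≤ Ψ ^ 2) {p₀ p₁ : V} (hp₀ : p₀ ∈ S) (hp₁ : p₁ ∈ S) {y z : ι} (hy : y ∈ cell p₀) (hz : z ∈ cell p₁)
    (hsmall : Real.exp 1 * (((max (exp (v * ((c₃ * h ^ 3 + 2 * c₂ * h ^ 2) + δ₀ * h ^ 2)) - 1)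
      (2 * exp (-((κ / 2 - ((κ₀ + 2 * c₂) + δ₀)) * h ^ 2)))) * exp (κ * (1 + τ⁻¹) * Ψ ^ 2 / 2)) *
      ((1 - θ) ^ (-(κ * (1 + τ) * γ / (2 * θ)))) ^ v) * ((Δ : ℝ) + 1) ^ 2 ≤ 1 / 2) {s t : ℝ} (hs : |s| ≤ 1) (ht : |t| ≤ 1) :
    ∫ ω : EuclideanSpace ℝ ι, exp (-(∑ p ∈ S, ∑ x ∈ cell p, w x (ω x + ψ₀ x))) * |G z (ω z + ψ₀ z)| *
        exp (s * F y (ω y + ψ₀ y) + t * G z (ω z + ψ₀ z)) ∂(multivariateGaussian 0 Γ) ≤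
      (∫ ω : EuclideanSpace ℝ ι, exp (-(∑ p ∈ S, ∑ x ∈ cell p, w x (ω x + ψ₀ x))) *
        exp (s * F y (ω y + ψ₀ y) + t * G z (ω z + ψ₀ z)) ∂(multivariateGaussian 0 Γ)) *
      (c₂ * δ₀⁻¹ * exp (2 * ((1 : ℝ) * ((Δ : ℝ) + 1) * (2 * (Real.exp 1 *
        (((max (exp (v * ((c₃ * h ^ 3 + 2 * c₂ * h ^ 2) + δ₀ * h ^ 2)) - 1) (2 * exp (-((κ / 2 - ((κ₀ + 2 * c₂) + δ₀)) * h ^ 2)))) *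
          exp (κ * (1 + τ⁻¹) * Ψ ^ 2 / 2)) * ((1 - θ) ^ (-(κ * (1 + τ) * γ / (2 * θ)))) ^ v)))))) := by
  have hφ : ∀ u : ℝ, |G z u| ≤ c₂ * δ₀⁻¹ * exp (δ₀ * u ^ 2) := fun u =>
    (hGq z u).trans (by rw [mul_assoc]; exact mul_le_mul_of_nonneg_left (sq_le_inv_mul_exp_sq hδ₀ u) hc₂)
  exact road_moment_letter hΓ hΓop hdiag hγ hfr hdisj hv hR hΔ hnbr hw hFm hGm hκ₀ hc₂ hc₃ hh hδ₀.le hstab hcub hFq hGq hκ hτ hθ0 hθ1 hκθ S ψ₀ hψ hp₀ hp₁ hp₁ hy hz hz hsmall (φ := fun u => |G z u|) (fun u => abs_nonneg _) hφ hs ht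
/-- **`∫Φ₀|A·A|e^{sA+tB} ≤ H·2c₂²δ₀⁻²M`** (`(F_y u)² ≤ c₂²u⁴ ≤ 2c₂²δ₀⁻²e^{δ₀u²}`). [folklore] -/
theorem letter_AA (hΓ : Γ.PosSemidef) (hΓop : (γop • (1 : Matrix ι ι ℝ) - Γ).PosSemidef) (hdiag : ∀ i, Γ i i ≤ γ) (hγ : 0 ≤ γ)
    (hfr : HasFiniteRange dι ρ Γ) (hdisj : ∀ p q, p ≠ q → Disjoint (cell p) (cell q)) (hv : ∀ p, (cell p).card ≤ v)
    (hR : ∀ (p p' : V) (x y : ι), x ∈ cell p → y ∈ cell p' → dι x y ≤ ρ → p = p' ∨ R p p') (hΔ : ∀ x, (nbr x).card ≤ Δ)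
    (hnbr : ∀ x y, R x y → y ∈ nbr x) (hw : ∀ x, Measurable (w x)) (hFm : ∀ x, Measurable (F x)) (hGm : ∀ x, Measurable (G x)) (hκ₀ : 0 ≤ κ₀)
    (hc₂ : 0 ≤ c₂) (hc₃ : 0 ≤ c₃) (hh : 0 ≤ h) (hδ₀ : 0 < δ₀) (hstab : ∀ x, ∀ u : ℝ, -(κ₀ * u ^ 2) ≤ w x u)
    (hcub : ∀ x, ∀ u : ℝ, |u| ≤ h → |w x u| ≤ c₃ * |u| ^ 3) (hFq : ∀ x u, |F x u| ≤ c₂ * u ^ 2) (hGq : ∀ x u, |G x u| ≤ c₂ * u ^ 2)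
    (hκ : 2 * ((κ₀ + 2 * c₂) + δ₀) ≤ κ) (hτ : 0 < τ) (hθ0 : 0 < θ) (hθ1 : θ < 1) (hκθ : κ * (1 + τ) * γop ≤ θ) (S : Finset V) (ψ₀ : EuclideanSpace ℝ ι)
    (hψ : ∀ p ∈ S, ∑ x ∈ cell p, ψ₀ x ^ 2 ≤ Ψ ^ 2) {p₀ p₁ : V} (hp₀ : p₀ ∈ S) (hp₁ : p₁ ∈ S) {y z : ι} (hy : y ∈ cell p₀) (hz : z ∈ cell p₁)
    (hsmall : Real.exp 1 * (((max (exp (v * ((c₃ * h ^ 3 + 2 * c₂ * h ^ 2) + δ₀ * h ^ 2)) - 1)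
      (2 * exp (-((κ / 2 - ((κ₀ + 2 * c₂) + δ₀)) * h ^ 2)))) * exp (κ * (1 + τ⁻¹) * Ψ ^ 2 / 2)) *
      ((1 - θ) ^ (-(κ * (1 + τ) * γ / (2 * θ)))) ^ v) * ((Δ : ℝ) + 1) ^ 2 ≤ 1 / 2) {s t : ℝ} (hs : |s| ≤ 1) (ht : |t| ≤ 1) :
    ∫ ω : EuclideanSpace ℝ ι, exp (-(∑ p ∈ S, ∑ x ∈ cell p, w x (ω x + ψ₀ x))) * |F y (ω y + ψ₀ y) * F y (ω y + ψ₀ y)| *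
        exp (s * F y (ω y + ψ₀ y) + t * G z (ω z + ψ₀ z)) ∂(multivariateGaussian 0 Γ) ≤
      (∫ ω : EuclideanSpace ℝ ι, exp (-(∑ p ∈ S, ∑ x ∈ cell p, w x (ω x + ψ₀ x))) *
        exp (s * F y (ω y + ψ₀ y) + t * G z (ω z + ψ₀ z)) ∂(multivariateGaussian 0 Γ)) *
      (2 * c₂ ^ 2 * (δ₀ ^ 2)⁻¹ * exp (2 * ((1 : ℝ) * ((Δ : ℝ) + 1) * (2 * (Real.exp 1 *
        (((max (exp (v * ((c₃ * h ^ 3 + 2 * c₂ * h ^ 2) + δ₀ * h ^ 2)) - 1) (2 * exp (-((κ / 2 - ((κ₀ + 2 * c₂) + δ₀)) * h ^ 2)))) *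
          exp (κ * (1 + τ⁻¹) * Ψ ^ 2 / 2)) * ((1 - θ) ^ (-(κ * (1 + τ) * γ / (2 * θ)))) ^ v)))))) := by
  have hφ : ∀ u : ℝ, |F y u * F y u| ≤ 2 * c₂ ^ 2 * (δ₀ ^ 2)⁻¹ * exp (δ₀ * u ^ 2) := fun u => by
    rw [abs_mul]
    have h1 := hFq y u
    have h2 := pow_four_le_mul_exp_sq hδ₀ u
    have h0 := abs_nonneg (F y u)
    calc |F y u| * |F y u| ≤ (c₂ * u ^ 2) * (c₂ * u ^ 2) := mul_le_mul h1 h1 h0 (by positivity)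
      _ = c₂ ^ 2 * u ^ 4 := by ring
      _ ≤ c₂ ^ 2 * (2 * (δ₀ ^ 2)⁻¹ * exp (δ₀ * u ^ 2)) := mul_le_mul_of_nonneg_left h2 (sq_nonneg _)
      _ = 2 * c₂ ^ 2 * (δ₀ ^ 2)⁻¹ * exp (δ₀ * u ^ 2) := by ring
  exact road_moment_letter hΓ hΓop hdiag hγ hfr hdisj hv hR hΔ hnbr hw hFm hGm hκ₀ hc₂ hc₃ hh hδ₀.le hstab hcub hFq hGq hκ hτ hθ0 hθ1 hκθ S ψ₀ hψ hp₀ hp₁ hp₀ hy hz hy hsmall (φ := fun u => |F y u * F y u|) (fun u => abs_nonneg _) hφ hs ht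
/-- **`∫Φ₀|B·B|e^{sA+tB} ≤ H·2c₂²δ₀⁻²M`**. [folklore] -/
theorem letter_BB (hΓ : Γ.PosSemidef) (hΓop : (γop • (1 : Matrix ι ι ℝ) - Γ).PosSemidef) (hdiag : ∀ i, Γ i i ≤ γ) (hγ : 0 ≤ γ)
    (hfr : HasFiniteRange dι ρ Γ) (hdisj : ∀ p q, p ≠ q → Disjoint (cell p) (cell q)) (hv : ∀ p, (cell p).card ≤ v)
    (hR : ∀ (p p' : V) (x y : ι), x ∈ cell p → y ∈ cell p' → dι x y ≤ ρ → p = p' ∨ R p p') (hΔ : ∀ x, (nbr x).card ≤ Δ)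
    (hnbr : ∀ x y, R x y → y ∈ nbr x) (hw : ∀ x, Measurable (w x)) (hFm : ∀ x, Measurable (F x)) (hGm : ∀ x, Measurable (G x)) (hκ₀ : 0 ≤ κ₀)
    (hc₂ : 0 ≤ c₂) (hc₃ : 0 ≤ c₃) (hh : 0 ≤ h) (hδ₀ : 0 < δ₀) (hstab : ∀ x, ∀ u : ℝ, -(κ₀ * u ^ 2) ≤ w x u)
    (hcub : ∀ x, ∀ u : ℝ, |u| ≤ h → |w x u| ≤ c₃ * |u| ^ 3) (hFq : ∀ x u, |F x u| ≤ c₂ * u ^ 2) (hGq : ∀ x u, |G x u| ≤ c₂ * u ^ 2)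
    (hκ : 2 * ((κ₀ + 2 * c₂) + δ₀) ≤ κ) (hτ : 0 < τ) (hθ0 : 0 < θ) (hθ1 : θ < 1) (hκθ : κ * (1 + τ) * γop ≤ θ) (S : Finset V) (ψ₀ : EuclideanSpace ℝ ι)
    (hψ : ∀ p ∈ S, ∑ x ∈ cell p, ψ₀ x ^ 2 ≤ Ψ ^ 2) {p₀ p₁ : V} (hp₀ : p₀ ∈ S) (hp₁ : p₁ ∈ S) {y z : ι} (hy : y ∈ cell p₀) (hz : z ∈ cell p₁)
    (hsmall : Real.exp 1 * (((max (exp (v * ((c₃ * h ^ 3 + 2 * c₂ * h ^ 2) + δ₀ * h ^ 2)) - 1)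
      (2 * exp (-((κ / 2 - ((κ₀ + 2 * c₂) + δ₀)) * h ^ 2)))) * exp (κ * (1 + τ⁻¹) * Ψ ^ 2 / 2)) *
      ((1 - θ) ^ (-(κ * (1 + τ) * γ / (2 * θ)))) ^ v) * ((Δ : ℝ) + 1) ^ 2 ≤ 1 / 2) {s t : ℝ} (hs : |s| ≤ 1) (ht : |t| ≤ 1) :
    ∫ ω : EuclideanSpace ℝ ι, exp (-(∑ p ∈ S, ∑ x ∈ cell p, w x (ω x + ψ₀ x))) * |G z (ω z + ψ₀ z) * G z (ω z + ψ₀ z)| *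
        exp (s * F y (ω y + ψ₀ y) + t * G z (ω z + ψ₀ z)) ∂(multivariateGaussian 0 Γ) ≤
      (∫ ω : EuclideanSpace ℝ ι, exp (-(∑ p ∈ S, ∑ x ∈ cell p, w x (ω x + ψ₀ x))) *
        exp (s * F y (ω y + ψ₀ y) + t * G z (ω z + ψ₀ z)) ∂(multivariateGaussian 0 Γ)) *
      (2 * c₂ ^ 2 * (δ₀ ^ 2)⁻¹ * exp (2 * ((1 : ℝ) * ((Δ : ℝ) + 1) * (2 * (Real.exp 1 *
        (((max (exp (v * ((c₃ * h ^ 3 + 2 * c₂ * h ^ 2) + δ₀ * h ^ 2)) - 1) (2 * exp (-((κ / 2 - ((κ₀ + 2 * c₂) + δ₀)) * h ^ 2)))) *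
          exp (κ * (1 + τ⁻¹) * Ψ ^ 2 / 2)) * ((1 - θ) ^ (-(κ * (1 + τ) * γ / (2 * θ)))) ^ v)))))) := by
  have hφ : ∀ u : ℝ, |G z u * G z u| ≤ 2 * c₂ ^ 2 * (δ₀ ^ 2)⁻¹ * exp (δ₀ * u ^ 2) := fun u => by
    rw [abs_mul]
    have h1 := hGq z u
    have h2 := pow_four_le_mul_exp_sq hδ₀ u
    have h0 := abs_nonneg (G z u)
    calc |G z u| * |G z u| ≤ (c₂ * u ^ 2) * (c₂ * u ^ 2) := mul_le_mul h1 h1 h0 (by positivity)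
      _ = c₂ ^ 2 * u ^ 4 := by ring
      _ ≤ c₂ ^ 2 * (2 * (δ₀ ^ 2)⁻¹ * exp (δ₀ * u ^ 2)) := mul_le_mul_of_nonneg_left h2 (sq_nonneg _)
      _ = 2 * c₂ ^ 2 * (δ₀ ^ 2)⁻¹ * exp (δ₀ * u ^ 2) := by ring
  exact road_moment_letter hΓ hΓop hdiag hγ hfr hdisj hv hR hΔ hnbr hw hFm hGm hκ₀ hc₂ hc₃ hh hδ₀.le hstab hcub hFq hGq hκ hτ hθ0 hθ1 hκθ S ψ₀ hψ hp₀ hp₁ hp₁ hy hz hz hsmall (φ := fun u => |G z u * G z u|) (fun u => abs_nonneg _) hφ hs ht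
/-- **`∫Φ₀|AB|e^{sA+tB} ≤ H·2c₂²δ₀⁻²M`** (`|AB| ≤ ½(A² + B²)`, the two square letters, integrability from the `4`-letter). [folklore] -/
theorem letter_AB (hΓ : Γ.PosSemidef) (hΓop : (γop • (1 : Matrix ι ι ℝ) - Γ).PosSemidef) (hdiag : ∀ i, Γ i i ≤ γ) (hγ : 0 ≤ γ)
    (hfr : HasFiniteRange dι ρ Γ) (hdisj : ∀ p q, p ≠ q → Disjoint (cell p) (cell q)) (hv : ∀ p, (cell p).card ≤ v)
    (hR : ∀ (p p' : V) (x y : ι), x ∈ cell p → y ∈ cell p' → dι x y ≤ ρ → p = p' ∨ R p p') (hΔ : ∀ x, (nbr x).card ≤ Δ)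
    (hnbr : ∀ x y, R x y → y ∈ nbr x) (hw : ∀ x, Measurable (w x)) (hFm : ∀ x, Measurable (F x)) (hGm : ∀ x, Measurable (G x)) (hκ₀ : 0 ≤ κ₀)
    (hc₂ : 0 ≤ c₂) (hc₃ : 0 ≤ c₃) (hh : 0 ≤ h) (hδ₀ : 0 < δ₀) (hstab : ∀ x, ∀ u : ℝ, -(κ₀ * u ^ 2) ≤ w x u)
    (hcub : ∀ x, ∀ u : ℝ, |u| ≤ h → |w x u| ≤ c₃ * |u| ^ 3) (hFq : ∀ x u, |F x u| ≤ c₂ * u ^ 2) (hGq : ∀ x u, |G x u| ≤ c₂ * u ^ 2)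
    (hκ : 2 * ((κ₀ + 2 * c₂) + δ₀) ≤ κ) (hτ : 0 < τ) (hθ0 : 0 < θ) (hθ1 : θ < 1) (hκθ : κ * (1 + τ) * γop ≤ θ)
    (hκθ₈ : 2 * (κ₀ + 2 * (4 * c₂)) * (1 + τ) * γop ≤ θ) (S : Finset V) (ψ₀ : EuclideanSpace ℝ ι)
    (hψ : ∀ p ∈ S, ∑ x ∈ cell p, ψ₀ x ^ 2 ≤ Ψ ^ 2) {p₀ p₁ : V} (hp₀ : p₀ ∈ S) (hp₁ : p₁ ∈ S) {y z : ι} (hy : y ∈ cell p₀) (hz : z ∈ cell p₁)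
    (hsmall : Real.exp 1 * (((max (exp (v * ((c₃ * h ^ 3 + 2 * c₂ * h ^ 2) + δ₀ * h ^ 2)) - 1)
      (2 * exp (-((κ / 2 - ((κ₀ + 2 * c₂) + δ₀)) * h ^ 2)))) * exp (κ * (1 + τ⁻¹) * Ψ ^ 2 / 2)) *
      ((1 - θ) ^ (-(κ * (1 + τ) * γ / (2 * θ)))) ^ v) * ((Δ : ℝ) + 1) ^ 2 ≤ 1 / 2) {s t : ℝ} (hs : |s| ≤ 1) (ht : |t| ≤ 1) :
    ∫ ω : EuclideanSpace ℝ ι, exp (-(∑ p ∈ S, ∑ x ∈ cell p, w x (ω x + ψ₀ x))) * |F y (ω y + ψ₀ y) * G z (ω z + ψ₀ z)| *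
        exp (s * F y (ω y + ψ₀ y) + t * G z (ω z + ψ₀ z)) ∂(multivariateGaussian 0 Γ) ≤
      (∫ ω : EuclideanSpace ℝ ι, exp (-(∑ p ∈ S, ∑ x ∈ cell p, w x (ω x + ψ₀ x))) *
        exp (s * F y (ω y + ψ₀ y) + t * G z (ω z + ψ₀ z)) ∂(multivariateGaussian 0 Γ)) *
      (2 * c₂ ^ 2 * (δ₀ ^ 2)⁻¹ * exp (2 * ((1 : ℝ) * ((Δ : ℝ) + 1) * (2 * (Real.exp 1 *
        (((max (exp (v * ((c₃ * h ^ 3 + 2 * c₂ * h ^ 2) + δ₀ * h ^ 2)) - 1) (2 * exp (-((κ / 2 - ((κ₀ + 2 * c₂) + δ₀)) * h ^ 2)))) *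
          exp (κ * (1 + τ⁻¹) * Ψ ^ 2 / 2)) * ((1 - θ) ^ (-(κ * (1 + τ) * γ / (2 * θ)))) ^ v)))))) := by
  have hAA := letter_AA hΓ hΓop hdiag hγ hfr hdisj hv hR hΔ hnbr hw hFm hGm hκ₀ hc₂ hc₃ hh hδ₀ hstab hcub hFq hGq hκ hτ hθ0 hθ1 hκθ S ψ₀ hψ
    hp₀ hp₁ hy hz hsmall hs ht
  have hBB := letter_BB hΓ hΓop hdiag hγ hfr hdisj hv hR hΔ hnbr hw hFm hGm hκ₀ hc₂ hc₃ hh hδ₀ hstab hcub hFq hGq hκ hτ hθ0 hθ1 hκθ S ψ₀ hψ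
    hp₀ hp₁ hy hz hsmall hs ht
  have hκθ₂ : 2 * (κ₀ + 2 * c₂) * (1 + τ) * γop ≤ θ :=
    SupEffectiveActionDerivative.mul_opBound_le_of_le (a := 2 * (κ₀ + 2 * c₂) * (1 + τ)) (b := κ * (1 + τ)) (by positivity)
      (mul_le_mul_of_nonneg_right (by linarith [hδ₀.le]) (by linarith)) hθ0.le (by simpa [mul_assoc] using hκθ) |> fun h' => by
        simpa [mul_assoc] using h'
  have hAm : Measurable fun ω : EuclideanSpace ℝ ι => F y (ω y + ψ₀ y) :=
    (hFm y).comp ((by fun_prop : Measurable fun ω : EuclideanSpace ℝ ι => ω y).add_const _)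
  have hBm : Measurable fun ω : EuclideanSpace ℝ ι => G z (ω z + ψ₀ z) :=
    (hGm z).comp ((by fun_prop : Measurable fun ω : EuclideanSpace ℝ ι => ω z).add_const _)
  -- integrability of the two square terms from the `4`-letter (`a² ≤ 2e^{|a|}`)
  have hsqle : ∀ a : ℝ, |a * a| ≤ 2 * exp |a| := fun a => by
    have hq := Real.quadratic_le_exp_of_nonneg (abs_nonneg a)
    rw [abs_mul]
    nlinarith [abs_nonneg a]
  have hXA : ∀ ω : EuclideanSpace ℝ ι, |(fun ω : EuclideanSpace ℝ ι => |F y (ω y + ψ₀ y) * F y (ω y + ψ₀ y)|) ω| ≤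
      2 * exp (2 * (|F y (ω y + ψ₀ y)| + |G z (ω z + ψ₀ z)|)) := fun ω => by
    dsimp only
    rw [abs_abs]
    refine (hsqle _).trans (mul_le_mul_of_nonneg_left (exp_le_exp.2 ?_) zero_le_two)
    nlinarith [abs_nonneg (F y (ω y + ψ₀ y)), abs_nonneg (G z (ω z + ψ₀ z))]
  have hXB : ∀ ω : EuclideanSpace ℝ ι, |(fun ω : EuclideanSpace ℝ ι => |G z (ω z + ψ₀ z) * G z (ω z + ψ₀ z)|) ω| ≤
      2 * exp (2 * (|F y (ω y + ψ₀ y)| + |G z (ω z + ψ₀ z)|)) := fun ω => by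
    dsimp only
    rw [abs_abs]
    refine (hsqle _).trans (mul_le_mul_of_nonneg_left (exp_le_exp.2 ?_) zero_le_two)
    nlinarith [abs_nonneg (F y (ω y + ψ₀ y)), abs_nonneg (G z (ω z + ψ₀ z))]
  have hIA := integrable_of_four_letter hΓ hΓop hdisj hw hFm hGm hκ₀ hc₂ hstab hFq hGq hτ hθ1 hκθ₈ S ψ₀ hp₀ hp₁ hy hz
    (X := fun ω => |F y (ω y + ψ₀ y) * F y (ω y + ψ₀ y)|) (continuous_abs.measurable.comp (hAm.mul hAm)) zero_le_two hXA hs ht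
  have hIB := integrable_of_four_letter hΓ hΓop hdisj hw hFm hGm hκ₀ hc₂ hstab hFq hGq hτ hθ1 hκθ₈ S ψ₀ hp₀ hp₁ hy hz
    (X := fun ω => |G z (ω z + ψ₀ z) * G z (ω z + ψ₀ z)|) (continuous_abs.measurable.comp (hBm.mul hBm)) zero_le_two hXB hs ht
  -- pointwise `|AB| ≤ ½(|A·A| + |B·B|)` and integrate
  have hmono := integral_mono_of_nonneg (μ := multivariateGaussian 0 Γ)
    (f := fun ω : EuclideanSpace ℝ ι => exp (-(∑ p ∈ S, ∑ x ∈ cell p, w x (ω x + ψ₀ x))) * |F y (ω y + ψ₀ y) * G z (ω z + ψ₀ z)| *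
      exp (s * F y (ω y + ψ₀ y) + t * G z (ω z + ψ₀ z)))
    (g := fun ω : EuclideanSpace ℝ ι => (exp (-(∑ p ∈ S, ∑ x ∈ cell p, w x (ω x + ψ₀ x))) * |F y (ω y + ψ₀ y) * F y (ω y + ψ₀ y)| *
        exp (s * F y (ω y + ψ₀ y) + t * G z (ω z + ψ₀ z)) + exp (-(∑ p ∈ S, ∑ x ∈ cell p, w x (ω x + ψ₀ x))) *
        |G z (ω z + ψ₀ z) * G z (ω z + ψ₀ z)| * exp (s * F y (ω y + ψ₀ y) + t * G z (ω z + ψ₀ z))) / 2)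
    (ae_of_all _ fun ω => by positivity) ((hIA.add hIB).div_const 2) (ae_of_all _ fun ω => by
      dsimp only
      have h := abs_mul_le_half_add (F y (ω y + ψ₀ y)) (G z (ω z + ψ₀ z))
      rw [← abs_mul_self (F y (ω y + ψ₀ y)), ← abs_mul_self (G z (ω z + ψ₀ z))] at h
      have he : 0 < exp (-(∑ p ∈ S, ∑ x ∈ cell p, w x (ω x + ψ₀ x))) := exp_pos _
      have he' : 0 < exp (s * F y (ω y + ψ₀ y) + t * G z (ω z + ψ₀ z)) := exp_pos _
      have := mul_le_mul_of_nonneg_left (mul_le_mul_of_nonneg_right h he'.le) he.le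
      calc _ = exp (-(∑ p ∈ S, ∑ x ∈ cell p, w x (ω x + ψ₀ x))) * (|F y (ω y + ψ₀ y) * G z (ω z + ψ₀ z)| *
            exp (s * F y (ω y + ψ₀ y) + t * G z (ω z + ψ₀ z))) := by ring
        _ ≤ _ := this
        _ = _ := by ring)
  rw [integral_div, integral_add hIA hIB] at hmono
  have hM0 : 0 ≤ (∫ ω : EuclideanSpace ℝ ι, exp (-(∑ p ∈ S, ∑ x ∈ cell p, w x (ω x + ψ₀ x))) *
        exp (s * F y (ω y + ψ₀ y) + t * G z (ω z + ψ₀ z)) ∂(multivariateGaussian 0 Γ)) := (road_H_pos hΓ hΓop hdisj hw hFm hGm hκ₀ hc₂ hstab hFq hGq hτ hθ1 hκθ₂ S ψ₀ hp₀ hp₁ hy hz hs ht).le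
  linarith [hmono, hAA, hBB]
/-- **`∫Φ₀|AB²|e^{sA+tB} ≤ H·6c₂³δ₀⁻³M`** (Young `|a|b² ≤ ⅓|a|³ + ⅔|b|³`, the two cube letters, integrability from the `4`-letter). [folklore] -/
theorem letter_ABB (hΓ : Γ.PosSemidef) (hΓop : (γop • (1 : Matrix ι ι ℝ) - Γ).PosSemidef) (hdiag : ∀ i, Γ i i ≤ γ) (hγ : 0 ≤ γ)
    (hfr : HasFiniteRange dι ρ Γ) (hdisj : ∀ p q, p ≠ q → Disjoint (cell p) (cell q)) (hv : ∀ p, (cell p).card ≤ v)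
    (hR : ∀ (p p' : V) (x y : ι), x ∈ cell p → y ∈ cell p' → dι x y ≤ ρ → p = p' ∨ R p p') (hΔ : ∀ x, (nbr x).card ≤ Δ)
    (hnbr : ∀ x y, R x y → y ∈ nbr x) (hw : ∀ x, Measurable (w x)) (hFm : ∀ x, Measurable (F x)) (hGm : ∀ x, Measurable (G x)) (hκ₀ : 0 ≤ κ₀)
    (hc₂ : 0 ≤ c₂) (hc₃ : 0 ≤ c₃) (hh : 0 ≤ h) (hδ₀ : 0 < δ₀) (hstab : ∀ x, ∀ u : ℝ, -(κ₀ * u ^ 2) ≤ w x u)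
    (hcub : ∀ x, ∀ u : ℝ, |u| ≤ h → |w x u| ≤ c₃ * |u| ^ 3) (hFq : ∀ x u, |F x u| ≤ c₂ * u ^ 2) (hGq : ∀ x u, |G x u| ≤ c₂ * u ^ 2)
    (hκ : 2 * ((κ₀ + 2 * c₂) + δ₀) ≤ κ) (hτ : 0 < τ) (hθ0 : 0 < θ) (hθ1 : θ < 1) (hκθ : κ * (1 + τ) * γop ≤ θ)
    (hκθ₈ : 2 * (κ₀ + 2 * (4 * c₂)) * (1 + τ) * γop ≤ θ) (S : Finset V) (ψ₀ : EuclideanSpace ℝ ι)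
    (hψ : ∀ p ∈ S, ∑ x ∈ cell p, ψ₀ x ^ 2 ≤ Ψ ^ 2) {p₀ p₁ : V} (hp₀ : p₀ ∈ S) (hp₁ : p₁ ∈ S) {y z : ι} (hy : y ∈ cell p₀) (hz : z ∈ cell p₁)
    (hsmall : Real.exp 1 * (((max (exp (v * ((c₃ * h ^ 3 + 2 * c₂ * h ^ 2) + δ₀ * h ^ 2)) - 1)
      (2 * exp (-((κ / 2 - ((κ₀ + 2 * c₂) + δ₀)) * h ^ 2)))) * exp (κ * (1 + τ⁻¹) * Ψ ^ 2 / 2)) *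
      ((1 - θ) ^ (-(κ * (1 + τ) * γ / (2 * θ)))) ^ v) * ((Δ : ℝ) + 1) ^ 2 ≤ 1 / 2) {s t : ℝ} (hs : |s| ≤ 1) (ht : |t| ≤ 1) :
    ∫ ω : EuclideanSpace ℝ ι, exp (-(∑ p ∈ S, ∑ x ∈ cell p, w x (ω x + ψ₀ x))) * |F y (ω y + ψ₀ y) * G z (ω z + ψ₀ z) * G z (ω z + ψ₀ z)| *
        exp (s * F y (ω y + ψ₀ y) + t * G z (ω z + ψ₀ z)) ∂(multivariateGaussian 0 Γ) ≤
      (∫ ω : EuclideanSpace ℝ ι, exp (-(∑ p ∈ S, ∑ x ∈ cell p, w x (ω x + ψ₀ x))) *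
        exp (s * F y (ω y + ψ₀ y) + t * G z (ω z + ψ₀ z)) ∂(multivariateGaussian 0 Γ)) *
      (6 * c₂ ^ 3 * (δ₀ ^ 3)⁻¹ * exp (2 * ((1 : ℝ) * ((Δ : ℝ) + 1) * (2 * (Real.exp 1 *
        (((max (exp (v * ((c₃ * h ^ 3 + 2 * c₂ * h ^ 2) + δ₀ * h ^ 2)) - 1) (2 * exp (-((κ / 2 - ((κ₀ + 2 * c₂) + δ₀)) * h ^ 2)))) *
          exp (κ * (1 + τ⁻¹) * Ψ ^ 2 / 2)) * ((1 - θ) ^ (-(κ * (1 + τ) * γ / (2 * θ)))) ^ v)))))) := by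
  have hκθ₂ : 2 * (κ₀ + 2 * c₂) * (1 + τ) * γop ≤ θ :=
    SupEffectiveActionDerivative.mul_opBound_le_of_le (a := 2 * (κ₀ + 2 * c₂) * (1 + τ)) (b := κ * (1 + τ)) (by positivity)
      (mul_le_mul_of_nonneg_right (by linarith [hδ₀.le]) (by linarith)) hθ0.le (by simpa [mul_assoc] using hκθ) |> fun h' => by
        simpa [mul_assoc] using h'
  -- the two cube letters at `y` and at `z`
  have hφA : ∀ u : ℝ, |F y u| ^ 3 ≤ 6 * c₂ ^ 3 * (δ₀ ^ 3)⁻¹ * exp (δ₀ * u ^ 2) := fun u => by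
    have h1 := hFq y u
    have h2 := pow_six_le_mul_exp_sq hδ₀ u
    calc |F y u| ^ 3 ≤ (c₂ * u ^ 2) ^ 3 := pow_le_pow_left₀ (abs_nonneg _) h1 3
      _ = c₂ ^ 3 * u ^ 6 := by ring
      _ ≤ c₂ ^ 3 * (6 * (δ₀ ^ 3)⁻¹ * exp (δ₀ * u ^ 2)) := mul_le_mul_of_nonneg_left h2 (pow_nonneg hc₂ 3)
      _ = 6 * c₂ ^ 3 * (δ₀ ^ 3)⁻¹ * exp (δ₀ * u ^ 2) := by ring
  have hφB : ∀ u : ℝ, |G z u| ^ 3 ≤ 6 * c₂ ^ 3 * (δ₀ ^ 3)⁻¹ * exp (δ₀ * u ^ 2) := fun u => by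
    have h1 := hGq z u
    have h2 := pow_six_le_mul_exp_sq hδ₀ u
    calc |G z u| ^ 3 ≤ (c₂ * u ^ 2) ^ 3 := pow_le_pow_left₀ (abs_nonneg _) h1 3
      _ = c₂ ^ 3 * u ^ 6 := by ring
      _ ≤ c₂ ^ 3 * (6 * (δ₀ ^ 3)⁻¹ * exp (δ₀ * u ^ 2)) := mul_le_mul_of_nonneg_left h2 (pow_nonneg hc₂ 3)
      _ = 6 * c₂ ^ 3 * (δ₀ ^ 3)⁻¹ * exp (δ₀ * u ^ 2) := by ring
  have hLA := road_moment_letter hΓ hΓop hdiag hγ hfr hdisj hv hR hΔ hnbr hw hFm hGm hκ₀ hc₂ hc₃ hh hδ₀.le hstab hcub hFq hGq hκ hτ hθ0 hθ1 hκθ S ψ₀ hψ hp₀ hp₁ hp₀ hy hz hy hsmall (φ := fun u => |F y u| ^ 3) (fun u => by positivity) hφA hs ht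
  have hLB := road_moment_letter hΓ hΓop hdiag hγ hfr hdisj hv hR hΔ hnbr hw hFm hGm hκ₀ hc₂ hc₃ hh hδ₀.le hstab hcub hFq hGq hκ hτ hθ0 hθ1 hκθ S ψ₀ hψ hp₀ hp₁ hp₁ hy hz hz hsmall (φ := fun u => |G z u| ^ 3) (fun u => by positivity) hφB hs ht
  have hAm : Measurable fun ω : EuclideanSpace ℝ ι => F y (ω y + ψ₀ y) :=
    (hFm y).comp ((by fun_prop : Measurable fun ω : EuclideanSpace ℝ ι => ω y).add_const _)
  have hBm : Measurable fun ω : EuclideanSpace ℝ ι => G z (ω z + ψ₀ z) :=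
    (hGm z).comp ((by fun_prop : Measurable fun ω : EuclideanSpace ℝ ι => ω z).add_const _)
  -- integrability of the two cube terms from the `4`-letter (`|a|³ ≤ 6e^{|a|}`)
  have hcub3 : ∀ a : ℝ, |a| ^ 3 ≤ 6 * exp |a| := fun a => by
    have hq := Real.pow_div_factorial_le_exp |a| (abs_nonneg a) 3
    rw [show Nat.factorial 3 = 6 from rfl] at hq
    push_cast at hq
    rw [div_le_iff₀ (by norm_num : (0 : ℝ) < 6)] at hq
    linarith
  have hXA : ∀ ω : EuclideanSpace ℝ ι, |(fun ω : EuclideanSpace ℝ ι => |F y (ω y + ψ₀ y)| ^ 3) ω| ≤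
      6 * exp (2 * (|F y (ω y + ψ₀ y)| + |G z (ω z + ψ₀ z)|)) := fun ω => by
    dsimp only
    rw [abs_of_nonneg (by positivity)]
    refine (hcub3 _).trans (mul_le_mul_of_nonneg_left (exp_le_exp.2 ?_) (by norm_num))
    nlinarith [abs_nonneg (F y (ω y + ψ₀ y)), abs_nonneg (G z (ω z + ψ₀ z))]
  have hXB : ∀ ω : EuclideanSpace ℝ ι, |(fun ω : EuclideanSpace ℝ ι => |G z (ω z + ψ₀ z)| ^ 3) ω| ≤
      6 * exp (2 * (|F y (ω y + ψ₀ y)| + |G z (ω z + ψ₀ z)|)) := fun ω => by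
    dsimp only
    rw [abs_of_nonneg (by positivity)]
    refine (hcub3 _).trans (mul_le_mul_of_nonneg_left (exp_le_exp.2 ?_) (by norm_num))
    nlinarith [abs_nonneg (F y (ω y + ψ₀ y)), abs_nonneg (G z (ω z + ψ₀ z))]
  have hIA := integrable_of_four_letter hΓ hΓop hdisj hw hFm hGm hκ₀ hc₂ hstab hFq hGq hτ hθ1 hκθ₈ S ψ₀ hp₀ hp₁ hy hz
    (X := fun ω => |F y (ω y + ψ₀ y)| ^ 3) ((continuous_abs.measurable.comp hAm).pow_const 3) (by norm_num) hXA hs ht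
  have hIB := integrable_of_four_letter hΓ hΓop hdisj hw hFm hGm hκ₀ hc₂ hstab hFq hGq hτ hθ1 hκθ₈ S ψ₀ hp₀ hp₁ hy hz
    (X := fun ω => |G z (ω z + ψ₀ z)| ^ 3) ((continuous_abs.measurable.comp hBm).pow_const 3) (by norm_num) hXB hs ht
  -- Young pointwise and integrate
  have hmono := integral_mono_of_nonneg (μ := multivariateGaussian 0 Γ)
    (f := fun ω : EuclideanSpace ℝ ι => exp (-(∑ p ∈ S, ∑ x ∈ cell p, w x (ω x + ψ₀ x))) *
      |F y (ω y + ψ₀ y) * G z (ω z + ψ₀ z) * G z (ω z + ψ₀ z)| * exp (s * F y (ω y + ψ₀ y) + t * G z (ω z + ψ₀ z)))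
    (g := fun ω : EuclideanSpace ℝ ι => exp (-(∑ p ∈ S, ∑ x ∈ cell p, w x (ω x + ψ₀ x))) * |F y (ω y + ψ₀ y)| ^ 3 *
        exp (s * F y (ω y + ψ₀ y) + t * G z (ω z + ψ₀ z)) / 3 + 2 * (exp (-(∑ p ∈ S, ∑ x ∈ cell p, w x (ω x + ψ₀ x))) *
        |G z (ω z + ψ₀ z)| ^ 3 * exp (s * F y (ω y + ψ₀ y) + t * G z (ω z + ψ₀ z))) / 3)
    (ae_of_all _ fun ω => by positivity) ((hIA.div_const 3).add ((hIB.const_mul 2).div_const 3)) (ae_of_all _ fun ω => by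
      dsimp only
      have h := young_one_two (F y (ω y + ψ₀ y)) (G z (ω z + ψ₀ z))
      rw [← abs_mul, ← abs_mul] at h
      have he : 0 < exp (-(∑ p ∈ S, ∑ x ∈ cell p, w x (ω x + ψ₀ x))) := exp_pos _
      have he' : 0 < exp (s * F y (ω y + ψ₀ y) + t * G z (ω z + ψ₀ z)) := exp_pos _
      have := mul_le_mul_of_nonneg_left (mul_le_mul_of_nonneg_right h he'.le) he.le
      calc _ = exp (-(∑ p ∈ S, ∑ x ∈ cell p, w x (ω x + ψ₀ x))) * (|F y (ω y + ψ₀ y) * G z (ω z + ψ₀ z) * G z (ω z + ψ₀ z)| *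
            exp (s * F y (ω y + ψ₀ y) + t * G z (ω z + ψ₀ z))) := by ring
        _ ≤ _ := this
        _ = _ := by ring)
  rw [integral_add (hIA.div_const 3) ((hIB.const_mul 2).div_const 3), integral_div, integral_div, integral_const_mul] at hmono
  have hM0 : 0 ≤ (∫ ω : EuclideanSpace ℝ ι, exp (-(∑ p ∈ S, ∑ x ∈ cell p, w x (ω x + ψ₀ x))) *
        exp (s * F y (ω y + ψ₀ y) + t * G z (ω z + ψ₀ z)) ∂(multivariateGaussian 0 Γ)) := (road_H_pos hΓ hΓop hdisj hw hFm hGm hκ₀ hc₂ hstab hFq hGq hτ hθ1 hκθ₂ S ψ₀ hp₀ hp₁ hy hz hs ht).le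
  linarith [hmono, hLA, hLB]

end Main

end Summit.QuantumFields.BalabanUV.T4Continuum.NE7b.SupTiltedMomentLetters
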